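import Mathlib
import Summits.KontsevichZagierPeriods.KontsevichZagierPeriods.Theorems.SoloInformedDecidedHulls
import Literature.NumberTheory.Transcendental.KZMellinFibres
import HarnessLib
import HarnessLib.Audit

/-!
# SoloInformed — reflection chains: `Γ(a)Γ(1−a) = π / sin πa` at `a = ¼, ⅙, ⅓` BY THE MOVES
(Theorem IX⁗, IV)

The paper's standing example of an identity between `ℚ`-Beta periods "predicted by `Rung₂`
(Gauss multiplication / reflection) with no explicit chain of Kontsevich–Zagier moves known" was
`⟦β(⅙,⅚)⟧ = 2⟦π⟧`. This file DERIVES it, and its level-4 and level-3 companions, in the ring of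
formal periods `P`, by composing moves already realised in the tree:
`soloInformed_reflection_quarter`: `⟦β(¼,¾)⟧ = ⟦[pt,√2]⟧·⟦π⟧`; `soloInformed_reflection_sixth`:
`⟦β(⅙,⅚)⟧ = 2⟦π⟧`; `soloInformed_reflection_third`: `⟦[pt,√3]⟧·⟦β(⅓,⅔)⟧ = 2⟦π⟧`.
Each chain was FOUND BY BREADTH-FIRST SEARCH in the monoid of Beta monomials with algebraic
coefficients over the relations realised by moves — unit exponent `⟦β(a,1)⟧ = ⟦[pt,1/a]⟧`
(Literature), Dirichlet re-association (Thm IX), the duplication chain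
`⟦[pt,4^a]⟧⟦β(a,a)⟧ = 2⟦β(a,½)⟧` (Thm IX⁗ II), the 3-isogeny chain (Thm IX‴), Euler's chain
(Thm IX′), the swap `t ↦ 1 − t`, and the arithmetic of the point field `K ⊂ P` (Thm IX⁗ I).
The only cancellations are of UNIT point classes (`8`, `12`): NO transcendental class is ever
cancelled — exactly what separates these chains from the `KZ.PiCancellation`-type step the summit
needs in general (paper §5). The same search certifies the NEGATIVE structural fact recorded in
the paper (§6octies): a lone non-reflection class `⟦β(i/6,j/6)⟧`, `i + j ≠ 6`, is rigid under
these binomial relations, so the five level-6 "cycle classes" are each decided only up to ONE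
`π`-cancellation (or a new one-class chain such as the 3-torsion chain described there).
Consequences: values (`soloInformed_reflection_values`) and `⟦β(¼,¾)⟧, ⟦β(⅙,⅚)⟧ ∈ K[⟦π⟧] ⊂`
every decided `K`-hull of Thm IX⁗ III (`soloInformed_reflection_mem_algHull`). Tools: the swap,
cancellation of non-zero point classes / naturals in `P`, point arithmetic.
Residency `solo-KontsevichZagierPeriods-informed` (s22); paper §0, §6octies, §8.

References: M. Kontsevich, D. Zagier, *Periods* (2001), §1.2, §4.3; A. Huber, G. Wüstholz,
*Transcendence and linear relations of 1-periods* (2022), Ch. 13–15.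
-/

noncomputable section

open MeasureTheory Set Filter
namespace Summit.KontsevichZagierPeriods.KontsevichZagierPeriods.Theorems

open Literature.NumberTheory.Transcendental Literature.NumberTheory.Transcendental.KZ
open Literature.ModelTheory.ExponentialFields

/-! ### Tools: swap, cancellation of point classes, point arithmetic -/

/-- **Swap** (move 2, the reflection `t ↦ 1 − t`): pinned `β(a,b)` and `β(b,a)` have the same
class in `P`. [this work] -/
theorem soloInformed_beta_swap (a b : ℚ) (M N : IntegralRep 1)
    (hMd : M.domain = {t | t 0 ∈ Ioo (0:ℝ) 1})
    (hMi : EqOn M.integrand (fun t => (t 0) ^ ((a : ℝ) - 1) * (1 - t 0) ^ ((b : ℝ) - 1)) M.domain)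
    (hNd : N.domain = {t | t 0 ∈ Ioo (0:ℝ) 1})
    (hNi : EqOn N.integrand (fun t => (t 0) ^ ((b : ℝ) - 1) * (1 - t 0) ^ ((a : ℝ) - 1)) N.domain) :
    toFormalPeriod (of M) = toFormalPeriod (of N) := by
  apply toFormalPeriod_eq_iff.mpr
  refine of_sub_of_mem_relations_of_boxReflection (0 : Fin 1) ?_ fun x hx => ?_
  · rw [hMd, hNd]
    ext x
    simp only [mem_setOf_eq, mem_preimage, boxReflection_apply_self, mem_Ioo]
    constructor <;> rintro ⟨h1, h2⟩ <;> constructor <;> linarith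
  · have hx' : boxReflection 0 x ∈ N.domain := by
      rw [hNd]
      rw [hMd] at hx
      simp only [mem_setOf_eq, boxReflection_apply_self, mem_Ioo] at hx ⊢
      constructor <;> linarith [hx.1, hx.2]
    rw [hMi hx, hNi hx']
    simp only [boxReflection_apply_self, sub_sub_cancel]
    ring

/-- **Point classes of non-zero algebraic numbers are cancellable** in `P`
(they are units: `⟦[pt,x⁻¹]⟧ · ⟦[pt,x]⟧ = 1`). [this work] -/
theorem soloInformed_pointRep_cancel (x : ℝ) (hx : IsAlgebraic ℚ x) (hx0 : x ≠ 0)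
    {u v : FormalPeriodRing}
    (h : toFormalPeriod (of (IntegralRep.unit.constMul x hx)) * u =
      toFormalPeriod (of (IntegralRep.unit.constMul x hx)) * v) : u = v := by
  have hxi : IsAlgebraic ℚ x⁻¹ := hx.inv
  have h1 := soloInformed_pointRep_inv_mul x hx hx0 hxi
  calc u = (toFormalPeriod (of (IntegralRep.unit.constMul x⁻¹ hxi)) *
        toFormalPeriod (of (IntegralRep.unit.constMul x hx))) * u := by rw [h1, one_mul]
    _ = toFormalPeriod (of (IntegralRep.unit.constMul x⁻¹ hxi)) *
        (toFormalPeriod (of (IntegralRep.unit.constMul x hx)) * v) := by rw [mul_assoc, h]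
    _ = v := by rw [← mul_assoc, h1, one_mul]

/-- **Natural-number point classes are cancellable**: `n · u = n · v → u = v` in `P` for
`0 < n` (`n = ⟦[pt,n]⟧` is a unit of `K ⊂ P`). [this work] -/
theorem soloInformed_natCast_cancel (n : ℕ) (hn : n ≠ 0) {u v : FormalPeriodRing}
    (h : (n : FormalPeriodRing) * u = (n : FormalPeriodRing) * v) : u = v := by
  have hna : IsAlgebraic ℚ (n : ℝ) := isAlgebraic_nat n
  rw [← toFormalPeriod_of_unit_constMul_natCast n hna] at h
  exact soloInformed_pointRep_cancel (n : ℝ) hna (by exact_mod_cast hn) h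

/-- Point arithmetic: `⟦[pt,x]⟧ · ⟦[pt,y]⟧ = ⟦[pt,z]⟧` whenever `x · y = z`. [this work] -/
theorem soloInformed_pointRep_mul_eq (x y z : ℝ) (hx : IsAlgebraic ℚ x) (hy : IsAlgebraic ℚ y)
    (hz : IsAlgebraic ℚ z) (h : x * y = z) :
    toFormalPeriod (of (IntegralRep.unit.constMul x hx)) *
      toFormalPeriod (of (IntegralRep.unit.constMul y hy)) =
        toFormalPeriod (of (IntegralRep.unit.constMul z hz)) := by
  rw [soloInformed_pointRep_mul x y hx hy (by rw [h]; exact hz)]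
  exact soloInformed_pointRep_congr _ _ h

/-- Point arithmetic with a natural number: `⟦[pt,x]⟧ · n = ⟦[pt,z]⟧` whenever `x · n = z`.
[this work] -/
theorem soloInformed_pointRep_mul_natCast_eq (x z : ℝ) (n : ℕ) (hx : IsAlgebraic ℚ x)
    (hz : IsAlgebraic ℚ z) (h : x * n = z) :
    toFormalPeriod (of (IntegralRep.unit.constMul x hx)) * (n : FormalPeriodRing) =
      toFormalPeriod (of (IntegralRep.unit.constMul z hz)) := by
  rw [← toFormalPeriod_of_unit_constMul_natCast n (isAlgebraic_nat n)]
  exact soloInformed_pointRep_mul_eq x n z hx _ hz h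

/-- `4^a` is algebraic for rational `a` (from the general `b^a` lemma). [folklore] -/
theorem soloInformed_isAlgebraic_four_rpow_ratCast (a : ℚ) :
    IsAlgebraic ℚ ((4:ℝ) ^ (a : ℝ)) ∧ (0:ℝ) < (4:ℝ) ^ (a : ℝ) :=
  ⟨by simpa using soloInformed_isAlgebraic_natCast_rpow_ratCast 4 (by norm_num) a,
    Real.rpow_pos_of_pos (by norm_num) _⟩

/-- `4^a · 4^b = 4^{a+b}` as point classes. [folklore] -/
theorem soloInformed_pointRep_four_rpow_mul (a b : ℚ) :
    toFormalPeriod (of (IntegralRep.unit.constMul ((4:ℝ) ^ (a : ℝ))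
        (soloInformed_isAlgebraic_four_rpow_ratCast a).1)) *
      toFormalPeriod (of (IntegralRep.unit.constMul ((4:ℝ) ^ (b : ℝ))
        (soloInformed_isAlgebraic_four_rpow_ratCast b).1)) =
      toFormalPeriod (of (IntegralRep.unit.constMul ((4:ℝ) ^ (((a + b : ℚ)) : ℝ))
        (soloInformed_isAlgebraic_four_rpow_ratCast (a + b)).1)) :=
  soloInformed_pointRep_mul_eq _ _ _ _ _ _ (by rw [Rat.cast_add, Real.rpow_add (by norm_num)])

/-! ### The three reflection chains -/

/-- **THEOREM IX⁗ (IV), level 4: the reflection chain `⟦β(¼,¾)⟧ = ⟦[pt,√2]⟧ · ⟦π⟧`**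
(`Γ(¼)Γ(¾) = π√2` DERIVED BY THE MOVES). The chain (found by breadth-first search in the monoid
of Beta monomials): unit exponent `⟦β(¼,1)⟧ = 4`; Dirichlet `(¼,¼,¾)`:
`⟦β(¼,¼)⟧⟦β(½,¾)⟧ = ⟦β(¼,¾)⟧⟦β(¼,1)⟧`; lemniscatic duplication `⟦[pt,√2]⟧⟦β(¼,¼)⟧ = 2⟦β(¼,½)⟧`;
swap; Euler `⟦β(¼,½)⟧⟦β(¾,½)⟧ = 4⟦π⟧`; finally cancellation of the UNIT `8 = ⟦[pt,8]⟧` (no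
transcendental class is ever cancelled). [this work] -/
theorem soloInformed_reflection_quarter (A : IntegralRep 1)
    (hAd : A.domain = {t | t 0 ∈ Ioo (0:ℝ) 1})
    (hAi : EqOn A.integrand
      (fun t => (t 0) ^ (((1 / 4 : ℚ) : ℝ) - 1) * (1 - t 0) ^ (((3 / 4 : ℚ) : ℝ) - 1)) A.domain) :
    toFormalPeriod (of A) = toFormalPeriod (of (IntegralRep.unit.constMul (Real.sqrt 2)
      (soloInformed_isAlgebraic_sqrt_natCast 2))) * toFormalPeriod (of KZ.piRep) := by
  have hq : (0 : ℚ) < 1 / 4 := by norm_num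
  have hh : (0 : ℚ) < 1 / 2 := by norm_num
  have h3 : (0 : ℚ) < 3 / 4 := by norm_num
  obtain ⟨L, hLd, hLi⟩ := exists_betaRep' (1 / 4) 1 hq one_pos
  obtain ⟨S, hSd, hSi⟩ := exists_betaRep' (1 / 4) (1 / 4) hq hq
  obtain ⟨M, hMd, hMi⟩ := exists_betaRep' (1 / 2) (3 / 4) hh h3
  obtain ⟨B, hBd, hBi⟩ := exists_betaRep' (1 / 4) (1 / 2) hq hh
  obtain ⟨B', hB'd, hB'i⟩ := exists_betaRep' (3 / 4) (1 / 2) h3 hh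
  -- unit exponent: ⟦L⟧ = 4
  have hainv : IsAlgebraic ℚ (((1 / 4 : ℚ) : ℝ))⁻¹ := by
    rw [← Rat.cast_inv]; exact isAlgebraic_algebraMap _
  have hL : toFormalPeriod (of L) = 4 := by
    rw [(betaFirst_equivalent_unit_constMul (1 / 4) hq L hLd (fun t _ => by rw [hLi])
      hainv).toFormalPeriod_eq, soloInformed_pointRep_congr (y := ((4 : ℕ) : ℝ)) hainv
      (isAlgebraic_nat 4) (by push_cast; norm_num), toFormalPeriod_of_unit_constMul_natCast]
    norm_num
  -- Dirichlet (¼,¼,¾): ⟦S⟧⟦M⟧ = ⟦A⟧⟦L⟧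
  have hD := soloInformed_dirichlet_reassociation (1 / 4) (1 / 4) (3 / 4) hq hq h3 S M A L
    hSd (fun t _ => by rw [hSi]) hMd (fun t _ => by rw [hMi]; norm_num) hAd hAi
    hLd (fun t _ => by rw [hLi]; norm_num)
  -- lemniscatic duplication: s ⟦S⟧ = 2 ⟦B⟧
  have hDup := soloInformed_lemniscatic_duplication S B hSd (fun t _ => by rw [hSi]) hBd
    (fun t _ => by rw [hBi])
  -- swap: ⟦M⟧ = ⟦B'⟧
  have hMs := soloInformed_beta_swap (1 / 2) (3 / 4) M B' hMd (fun t _ => by rw [hMi]) hB'd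
    (fun t _ => by rw [hB'i])
  -- Euler: ⟦B⟧⟦B'⟧ = 4⟦π⟧
  have hE := soloInformed_euler_lemniscate B B' hBd (fun t _ => by rw [hBi]) hB'd
    (fun t _ => by rw [hB'i])
  set s := toFormalPeriod (of (IntegralRep.unit.constMul (Real.sqrt 2)
    (soloInformed_isAlgebraic_sqrt_natCast 2))) with hs_def
  have hss : s * s = 2 := by
    rw [hs_def, soloInformed_pointRep_mul_eq (Real.sqrt 2) (Real.sqrt 2) ((2 : ℕ) : ℝ) _ _
      (isAlgebraic_nat 2) (by push_cast; exact Real.mul_self_sqrt (by norm_num)),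
      toFormalPeriod_of_unit_constMul_natCast]
    norm_num
  have e1 : (8 : FormalPeriodRing) * toFormalPeriod (of A) =
      2 * (toFormalPeriod (of S) * toFormalPeriod (of M)) := by
    linear_combination (-2 * toFormalPeriod (of A)) * hL + (-2) * hD
  have e2 : 2 * (toFormalPeriod (of S) * toFormalPeriod (of M)) =
      2 * s * (toFormalPeriod (of B) * toFormalPeriod (of B')) := by
    linear_combination (-(toFormalPeriod (of S) * toFormalPeriod (of M))) * hss +
      (s * toFormalPeriod (of M)) * hDup + (2 * s * toFormalPeriod (of B)) * hMs
  have e3 : 2 * s * (toFormalPeriod (of B) * toFormalPeriod (of B')) =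
      8 * (s * toFormalPeriod (of KZ.piRep)) := by
    linear_combination (2 * s) * hE
  exact soloInformed_natCast_cancel 8 (by norm_num) (by exact_mod_cast e1.trans (e2.trans e3))

/-- **THEOREM IX⁗ (IV), level 6: the reflection chain `⟦β(⅙,⅚)⟧ = 2 · ⟦π⟧`**
(`Γ(⅙)Γ(⅚) = 2π` DERIVED BY THE MOVES) — the paper's standing example of an identity
"predicted by `Rung₂` with no explicit chain known". The chain (breadth-first search, 6 moves):
unit exponent `⟦β(⅔,1)⟧ = ⟦[pt,3/2]⟧`; Dirichlet `(⅔,⅙,⅚)`; duplication at `a = ⅚`;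
Dirichlet `(½,⅙,⅔)`; duplication at `a = ⅔`; Euler `⟦β(⅙,½)⟧⟦β(⅔,½)⟧ = 6⟦π⟧`; three swaps;
point arithmetic `4^{2/3}·4^{5/6} = 8`, `8 · 3/2 = 12`; cancellation of the unit `12`.
[this work] -/
theorem soloInformed_reflection_sixth (A : IntegralRep 1)
    (hAd : A.domain = {t | t 0 ∈ Ioo (0:ℝ) 1})
    (hAi : EqOn A.integrand
      (fun t => (t 0) ^ (((1 / 6 : ℚ) : ℝ) - 1) * (1 - t 0) ^ (((5 / 6 : ℚ) : ℝ) - 1)) A.domain) :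
    toFormalPeriod (of A) = 2 * toFormalPeriod (of KZ.piRep) := by
  have h16 : (0 : ℚ) < 1 / 6 := by norm_num
  have hh : (0 : ℚ) < 1 / 2 := by norm_num
  have h23 : (0 : ℚ) < 2 / 3 := by norm_num
  have h56 : (0 : ℚ) < 5 / 6 := by norm_num
  obtain ⟨L, hLd, hLi⟩ := exists_betaRep' (2 / 3) 1 h23 one_pos
  obtain ⟨D, hDd, hDi⟩ := exists_betaRep' (2 / 3) (1 / 6) h23 h16
  obtain ⟨F, hFd, hFi⟩ := exists_betaRep' (5 / 6) (5 / 6) h56 h56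
  obtain ⟨F', hF'd, hF'i⟩ := exists_betaRep' (5 / 6) (1 / 2) h56 hh
  obtain ⟨H, hHd, hHi⟩ := exists_betaRep' (1 / 2) (1 / 6) hh h16
  obtain ⟨G, hGd, hGi⟩ := exists_betaRep' (2 / 3) (2 / 3) h23 h23
  obtain ⟨E, hEd, hEi⟩ := exists_betaRep' (1 / 6) (2 / 3) h16 h23
  obtain ⟨M, hMd, hMi⟩ := exists_betaRep' (1 / 2) (5 / 6) hh h56
  obtain ⟨G', hG'd, hG'i⟩ := exists_betaRep' (2 / 3) (1 / 2) h23 hh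
  obtain ⟨U, hUd, hUi⟩ := exists_betaRep' (1 / 6) (1 / 2) h16 hh
  -- unit exponent: ⟦L⟧ = ℓ = ⟦[pt, (2/3)⁻¹]⟧
  have hlinv : IsAlgebraic ℚ (((2 / 3 : ℚ) : ℝ))⁻¹ := by
    rw [← Rat.cast_inv]; exact isAlgebraic_algebraMap _
  have hL := (betaFirst_equivalent_unit_constMul (2 / 3) h23 L hLd (fun t _ => by rw [hLi])
    hlinv).toFormalPeriod_eq
  set ℓ := toFormalPeriod (of (IntegralRep.unit.constMul (((2 / 3 : ℚ) : ℝ))⁻¹ hlinv))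
    with hl_def
  -- Dirichlet (⅔,⅙,⅚): ⟦D⟧⟦F⟧ = ⟦A⟧⟦L⟧
  have hD1 := soloInformed_dirichlet_reassociation (2 / 3) (1 / 6) (5 / 6) h23 h16 h56 D F A L
    hDd (fun t _ => by rw [hDi]) hFd (fun t _ => by rw [hFi]; norm_num) hAd hAi
    hLd (fun t _ => by rw [hLi]; norm_num)
  -- duplication at ⅚: u₅ ⟦F⟧ = 2 ⟦F'⟧
  have hDup5 := soloInformed_duplication_chain (5 / 6)
    (soloInformed_isAlgebraic_four_rpow_ratCast (5 / 6)).1 F F' hFd (fun t _ => by rw [hFi])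
    hF'd (fun t _ => by rw [hF'i])
  set u₅ := toFormalPeriod (of (IntegralRep.unit.constMul ((4:ℝ) ^ (((5 / 6 : ℚ)) : ℝ))
    (soloInformed_isAlgebraic_four_rpow_ratCast (5 / 6)).1)) with hu5_def
  -- Dirichlet (½,⅙,⅔): ⟦H⟧⟦G⟧ = ⟦E⟧⟦M⟧
  have hD2 := soloInformed_dirichlet_reassociation (1 / 2) (1 / 6) (2 / 3) hh h16 h23 H G E M
    hHd (fun t _ => by rw [hHi]) hGd (fun t _ => by rw [hGi]; norm_num) hEd (fun t _ => by rw [hEi])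
    hMd (fun t _ => by rw [hMi]; norm_num)
  -- duplication at ⅔: u₄ ⟦G⟧ = 2 ⟦G'⟧
  have hDup4 := soloInformed_duplication_chain (2 / 3)
    (soloInformed_isAlgebraic_four_rpow_ratCast (2 / 3)).1 G G' hGd (fun t _ => by rw [hGi])
    hG'd (fun t _ => by rw [hG'i])
  set u₄ := toFormalPeriod (of (IntegralRep.unit.constMul ((4:ℝ) ^ (((2 / 3 : ℚ)) : ℝ))
    (soloInformed_isAlgebraic_four_rpow_ratCast (2 / 3)).1)) with hu4_def
  -- Euler (a = ⅙): ⟦U⟧⟦G'⟧ = 6⟦π⟧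
  have hEu := soloInformed_euler_beta_family 1 6 U G' one_pos (by norm_num) hUd
    (fun t _ => by rw [hUi]; norm_num) hG'd (fun t _ => by rw [hG'i]; norm_num)
  simp only [Nat.cast_one, one_mul] at hEu
  have hsw1 := soloInformed_beta_swap (2 / 3) (1 / 6) D E hDd (fun t _ => by rw [hDi]) hEd
    (fun t _ => by rw [hEi])
  have hsw2 := soloInformed_beta_swap (5 / 6) (1 / 2) F' M hF'd (fun t _ => by rw [hF'i]) hMd
    (fun t _ => by rw [hMi])
  have hsw3 := soloInformed_beta_swap (1 / 2) (1 / 6) H U hHd (fun t _ => by rw [hHi]) hUd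
    (fun t _ => by rw [hUi])
  -- point arithmetic: 4^{3/2} = 8, u₄ u₅ = 8, ℓ · 8 = 12
  have h8 : (4:ℝ) ^ (((3 / 2 : ℚ)) : ℝ) = 8 := by
    have h1 : (0:ℝ) ≤ (4:ℝ) ^ (((3 / 2 : ℚ)) : ℝ) := Real.rpow_nonneg (by norm_num) _
    rw [← pow_left_inj₀ h1 (by norm_num : (0:ℝ) ≤ 8) (by norm_num : (2:ℕ) ≠ 0),
      ← Real.rpow_natCast, ← Real.rpow_mul (by norm_num)]
    push_cast
    norm_num
  have h45 : u₄ * u₅ = 8 := by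
    rw [hu4_def, hu5_def, soloInformed_pointRep_four_rpow_mul,
      soloInformed_pointRep_congr (y := ((8 : ℕ) : ℝ)) _ (isAlgebraic_nat 8)
      (by rw [show (2 / 3 + 5 / 6 : ℚ) = 3 / 2 by norm_num, h8]; norm_num),
      toFormalPeriod_of_unit_constMul_natCast]
    norm_num
  have hl8 : ℓ * 8 = 12 := by
    have := soloInformed_pointRep_mul_natCast_eq ((((2 / 3 : ℚ) : ℝ))⁻¹) ((12 : ℕ) : ℝ) 8 hlinv
      (isAlgebraic_nat 12) (by push_cast; norm_num)
    rw [toFormalPeriod_of_unit_constMul_natCast] at this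
    rw [hl_def]
    exact_mod_cast this
  have e1 : u₅ * ℓ * toFormalPeriod (of A) = 2 * (toFormalPeriod (of U) * toFormalPeriod (of G)) := by
    linear_combination (-u₅ * toFormalPeriod (of A)) * hL + (-u₅) * hD1 +
      toFormalPeriod (of D) * hDup5 + (2 * toFormalPeriod (of F')) * hsw1 +
      (2 * toFormalPeriod (of E)) * hsw2 + (-2) * hD2 + (2 * toFormalPeriod (of G)) * hsw3
  have e2 : (12 : FormalPeriodRing) * toFormalPeriod (of A) =
      12 * (2 * toFormalPeriod (of KZ.piRep)) := by
    linear_combination (-(ℓ * toFormalPeriod (of A))) * h45 + u₄ * e1 +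
      (2 * toFormalPeriod (of U)) * hDup4 + 4 * hEu + (-(toFormalPeriod (of A))) * hl8
  exact soloInformed_natCast_cancel 12 (by norm_num) (by exact_mod_cast e2)

/-- **THEOREM IX⁗ (IV), level 3: the reflection chain `⟦[pt,√3]⟧ · ⟦β(⅓,⅔)⟧ = 2 · ⟦π⟧`**
(`Γ(⅓)Γ(⅔) = 2π/√3` DERIVED BY THE MOVES). The chain (breadth-first search, 6 moves): unit
exponent `⟦β(⅓,1)⟧ = 3`; Dirichlet `(⅓,⅓,⅔)`; duplications at `a = ⅓` and `a = ⅔`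
(`4^{1/3}·4^{2/3} = 4`); the 3-ISOGENY chain `⟦β(⅙,½)⟧ = ⟦[pt,√3]⟧⟦β(⅓,½)⟧` of Theorem IX‴;
Euler at `a = ⅙`; cancellation of the unit `12`. [this work] -/
theorem soloInformed_reflection_third (A : IntegralRep 1)
    (hAd : A.domain = {t | t 0 ∈ Ioo (0:ℝ) 1})
    (hAi : EqOn A.integrand
      (fun t => (t 0) ^ (((1 / 3 : ℚ) : ℝ) - 1) * (1 - t 0) ^ (((2 / 3 : ℚ) : ℝ) - 1)) A.domain) :
    toFormalPeriod (of (IntegralRep.unit.constMul (Real.sqrt 3)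
      (soloInformed_isAlgebraic_sqrt_natCast 3))) * toFormalPeriod (of A) =
      2 * toFormalPeriod (of KZ.piRep) := by
  have h13 : (0 : ℚ) < 1 / 3 := by norm_num
  have h16 : (0 : ℚ) < 1 / 6 := by norm_num
  have hh : (0 : ℚ) < 1 / 2 := by norm_num
  have h23 : (0 : ℚ) < 2 / 3 := by norm_num
  obtain ⟨L, hLd, hLi⟩ := exists_betaRep' (1 / 3) 1 h13 one_pos
  obtain ⟨S, hSd, hSi⟩ := exists_betaRep' (1 / 3) (1 / 3) h13 h13
  obtain ⟨G, hGd, hGi⟩ := exists_betaRep' (2 / 3) (2 / 3) h23 h23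
  obtain ⟨U₃, hU₃d, hU₃i⟩ := exists_betaRep' (1 / 3) (1 / 2) h13 hh
  obtain ⟨G', hG'd, hG'i⟩ := exists_betaRep' (2 / 3) (1 / 2) h23 hh
  obtain ⟨U, hUd, hUi⟩ := exists_betaRep' (1 / 6) (1 / 2) h16 hh
  -- unit exponent: ⟦L⟧ = 3
  have hainv : IsAlgebraic ℚ (((1 / 3 : ℚ) : ℝ))⁻¹ := by
    rw [← Rat.cast_inv]; exact isAlgebraic_algebraMap _
  have hL : toFormalPeriod (of L) = 3 := by
    rw [(betaFirst_equivalent_unit_constMul (1 / 3) h13 L hLd (fun t _ => by rw [hLi])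
      hainv).toFormalPeriod_eq, soloInformed_pointRep_congr (y := ((3 : ℕ) : ℝ)) hainv
      (isAlgebraic_nat 3) (by push_cast; norm_num), toFormalPeriod_of_unit_constMul_natCast]
    norm_num
  -- Dirichlet (⅓,⅓,⅔): ⟦S⟧⟦G⟧ = ⟦A⟧⟦L⟧
  have hD := soloInformed_dirichlet_reassociation (1 / 3) (1 / 3) (2 / 3) h13 h13 h23 S G A L
    hSd (fun t _ => by rw [hSi]) hGd (fun t _ => by rw [hGi]; norm_num) hAd hAi
    hLd (fun t _ => by rw [hLi]; norm_num)
  -- duplications at ⅓ and ⅔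
  have hDup2 := soloInformed_duplication_chain (1 / 3)
    (soloInformed_isAlgebraic_four_rpow_ratCast (1 / 3)).1 S U₃ hSd (fun t _ => by rw [hSi])
    hU₃d (fun t _ => by rw [hU₃i])
  set u₂ := toFormalPeriod (of (IntegralRep.unit.constMul ((4:ℝ) ^ (((1 / 3 : ℚ)) : ℝ))
    (soloInformed_isAlgebraic_four_rpow_ratCast (1 / 3)).1)) with hu2_def
  have hDup4 := soloInformed_duplication_chain (2 / 3)
    (soloInformed_isAlgebraic_four_rpow_ratCast (2 / 3)).1 G G' hGd (fun t _ => by rw [hGi])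
    hG'd (fun t _ => by rw [hG'i])
  set u₄ := toFormalPeriod (of (IntegralRep.unit.constMul ((4:ℝ) ^ (((2 / 3 : ℚ)) : ℝ))
    (soloInformed_isAlgebraic_four_rpow_ratCast (2 / 3)).1)) with hu4_def
  -- isogeny: ⟦U⟧ = s₃ ⟦U₃⟧
  have hIso := soloInformed_isogeny_chain U₃ U hU₃d (fun t _ => by rw [hU₃i]) hUd
    (fun t _ => by rw [hUi])
  set s₃ := toFormalPeriod (of (IntegralRep.unit.constMul (Real.sqrt 3)
    (soloInformed_isAlgebraic_sqrt_natCast 3))) with hs3_def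
  -- Euler (a = ⅙): ⟦U⟧⟦G'⟧ = 6⟦π⟧
  have hEu := soloInformed_euler_beta_family 1 6 U G' one_pos (by norm_num) hUd
    (fun t _ => by rw [hUi]; norm_num) hG'd (fun t _ => by rw [hG'i]; norm_num)
  simp only [Nat.cast_one, one_mul] at hEu
  -- point arithmetic: u₂ u₄ = 4
  have h24 : u₂ * u₄ = 4 := by
    rw [hu2_def, hu4_def, soloInformed_pointRep_four_rpow_mul,
      soloInformed_pointRep_congr (y := ((4 : ℕ) : ℝ)) _ (isAlgebraic_nat 4)
      (by rw [show (1 / 3 + 2 / 3 : ℚ) = 1 by norm_num]; push_cast; exact Real.rpow_one _),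
      toFormalPeriod_of_unit_constMul_natCast]
    norm_num
  have e1 : (12 : FormalPeriodRing) * toFormalPeriod (of A) =
      4 * (toFormalPeriod (of U₃) * toFormalPeriod (of G')) := by
    linear_combination (-(4 : FormalPeriodRing) * toFormalPeriod (of A)) * hL +
      (-(toFormalPeriod (of A) * toFormalPeriod (of L))) * h24 + (-(u₂ * u₄)) * hD +
      (u₄ * toFormalPeriod (of G)) * hDup2 + (2 * toFormalPeriod (of U₃)) * hDup4
  have e2 : (12 : FormalPeriodRing) * (s₃ * toFormalPeriod (of A)) =
      12 * (2 * toFormalPeriod (of KZ.piRep)) := by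
    linear_combination s₃ * e1 + (-(4 * toFormalPeriod (of G'))) * hIso + 4 * hEu
  exact soloInformed_natCast_cancel 12 (by norm_num) (by exact_mod_cast e2)

/-! ### Values and hull memberships -/

/-- **Values**: `B(¼,¾) = √2·π`, `B(⅙,⅚) = 2π`, `√3 · B(⅓,⅔) = 2π` (Euler's reflection formula
at `¼, ⅙, ⅓`, here COROLLARIES of the chains). [this work] -/
theorem soloInformed_reflection_values (A₄ A₆ A₃ : IntegralRep 1)
    (h₄d : A₄.domain = {t | t 0 ∈ Ioo (0:ℝ) 1})
    (h₄i : EqOn A₄.integrand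
      (fun t => (t 0) ^ (((1 / 4 : ℚ) : ℝ) - 1) * (1 - t 0) ^ (((3 / 4 : ℚ) : ℝ) - 1)) A₄.domain)
    (h₆d : A₆.domain = {t | t 0 ∈ Ioo (0:ℝ) 1})
    (h₆i : EqOn A₆.integrand
      (fun t => (t 0) ^ (((1 / 6 : ℚ) : ℝ) - 1) * (1 - t 0) ^ (((5 / 6 : ℚ) : ℝ) - 1)) A₆.domain)
    (h₃d : A₃.domain = {t | t 0 ∈ Ioo (0:ℝ) 1})
    (h₃i : EqOn A₃.integrand
      (fun t => (t 0) ^ (((1 / 3 : ℚ) : ℝ) - 1) * (1 - t 0) ^ (((2 / 3 : ℚ) : ℝ) - 1)) A₃.domain) :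
    A₄.value = Real.sqrt 2 * Real.pi ∧ A₆.value = 2 * Real.pi ∧
      Real.sqrt 3 * A₃.value = 2 * Real.pi := by
  refine ⟨?_, ?_, ?_⟩
  · have h := congr_arg evalP (soloInformed_reflection_quarter A₄ h₄d h₄i)
    rwa [map_mul, evalP_toFormalPeriod_of, evalP_toFormalPeriod_of, evalP_toFormalPeriod_of,
      IntegralRep.value_constMul, IntegralRep.value_unit, mul_one, piRep_value] at h
  · have h := congr_arg evalP (soloInformed_reflection_sixth A₆ h₆d h₆i)
    rwa [map_mul, evalP_toFormalPeriod_of, evalP_toFormalPeriod_of, map_ofNat, piRep_value] at h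
  · have h := congr_arg evalP (soloInformed_reflection_third A₃ h₃d h₃i)
    rwa [map_mul, map_mul, evalP_toFormalPeriod_of, evalP_toFormalPeriod_of,
      evalP_toFormalPeriod_of, IntegralRep.value_constMul, IntegralRep.value_unit, mul_one,
      map_ofNat, piRep_value] at h

/-- **Hull membership**: the reflection classes `⟦β(¼,¾)⟧`, `⟦β(⅙,⅚)⟧` lie in EVERY `K`-hull
containing `⟦π⟧` (they are `K`-multiples of `⟦π⟧`), hence in each decided hull of Theorem IX⁗.
[this work] -/
theorem soloInformed_reflection_mem_algHull (A₄ A₆ : IntegralRep 1)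
    (h₄d : A₄.domain = {t | t 0 ∈ Ioo (0:ℝ) 1})
    (h₄i : EqOn A₄.integrand
      (fun t => (t 0) ^ (((1 / 4 : ℚ) : ℝ) - 1) * (1 - t 0) ^ (((3 / 4 : ℚ) : ℝ) - 1)) A₄.domain)
    (h₆d : A₆.domain = {t | t 0 ∈ Ioo (0:ℝ) 1})
    (h₆i : EqOn A₆.integrand
      (fun t => (t 0) ^ (((1 / 6 : ℚ) : ℝ) - 1) * (1 - t 0) ^ (((5 / 6 : ℚ) : ℝ) - 1)) A₆.domain)
    {k : ℕ} (c : Fin k → FormalPeriodRing) (hπ : toFormalPeriod (of KZ.piRep) ∈ soloInformedAlgHull c) :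
    toFormalPeriod (of A₄) ∈ soloInformedAlgHull c ∧ toFormalPeriod (of A₆) ∈ soloInformedAlgHull c := by
  refine ⟨?_, ?_⟩
  · rw [soloInformed_reflection_quarter A₄ h₄d h₄i]
    exact mul_mem (soloInformed_pointRep_mem_algHull c _ _) hπ
  · rw [soloInformed_reflection_sixth A₆ h₆d h₆i]
    exact mul_mem (ofNat_mem _ 2) hπ

end Summit.KontsevichZagierPeriods.KontsevichZagierPeriods.Theorems

end
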